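import Mathlib.Analysis.Calculus.ContDiff.Defs
import Literature.AlgebraicTopology.SingularHomology.SingularChainsConcrete
import Literature.NumberTheory.Transcendental.SemialgebraicMaps
import HarnessLib

/-!
# Semialgebraic singular chains compute singular homology (Huber 2023/24, Prop. 7.4)

Topic `ModelTheory/ExponentialFields` (where the tree keeps semialgebraic geometry:
`Semialgebraic`, `SemialgebraicMaps`, `SemialgebraicTriangulation`), family `periods`.
Requested by route `KontsevichZagierPeriods/CobordismMove` (cite item "semialgebraic chains compute
homology": a semialgebraic cycle that is null-homologous bounds a semialgebraic chain).

## What is printed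

A. Huber, *The period isomorphism in tame geometry* (Math. Nachr. 2024; arXiv:2204.01402v2),
§5 and §7. Setting (§5, §7): "We fix an o-minimal structure on the real field. By definable we
always mean definable with parameters in a fixed subfield `k` of `ℝ`. … An example is the theory of
semi-algebraic sets of `ℝ^N` for `N ≥ 0` defined over `k`. Our discussion was chosen to apply to this
case." "Throughout this section, let `X` be a definable `C^∞`-manifold with corners" (i.e. [CommelinHabeggerHuber2020,
Ch. 3]: "manifolds with corners in the sense of Definition 4.3 with a finite atlas and definable
transition maps"). Notation 7.1: "`S^sing_d(X)` the free abelian group with basis continuous maps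
`σ : Δ_d → X`; … `S^{def,C¹}_d(X)` the free abelian group with basis definable continuous maps
`σ : Δ_d → X` which are `C¹` on all open faces; `S^def_d(X)` the free abelian group with basis
definable continuous maps `σ : Δ_d → X` … In each case, the groups organise into a complex with the
standard differential for singular homology". **Proposition 7.4.** "The inclusions
`S^def_•(X) ⊂ S^sing_•(X)`, `S^{def,C¹}_•(X) ⊂ S^def_•(X)`, … are natural quasi-isomorphisms" (proof:
"All complexes compute singular homology. … The same proof [Warner's fine-resolution argument,
Thm. 4.7] also applies in the definable cases `S^def_•(X)` and `S^{def,C¹}_•(X)` because `σ̂` is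
definable (and `C¹` on open faces) if `σ` is. Alternatively, we use Remark 7.2 and apply the main
comparison theorem of Edmundo and Woerheide in [EW08] to singular homology and definable
homology"). Remark 7.2: "The complexes `S^def_•(X)` are the ones appearing already in the definition
of definable homology in [EW08] by Edmundo–Woerheide".

## What is vendored

* `SingularSimplex.extend σ` — a singular simplex `σ : Δ^d → ℝ^N` of the tree's concrete model
  (`Literature.AlgebraicTopology.SingularHomology.SingularSimplex`, a continuous map on Mathlib's
  `stdSimplex ℝ (Fin (d+1)) ⊆ ℝ^{d+1}`) extended by `0` to a function `ℝ^{d+1} → ℝ^N`; `IsSemialg k σ`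
  — "`σ` is definable": its graph over `Δ^d` is `k`-semialgebraic (`IsSemialgebraicMapOn k`, BCR
  Def. 2.2.5); `openFace d J` — the open faces of `Δ^d`; `ContDiffOnOpenFaces σ` — "`C¹` on all open
  faces" (Mathlib `ContDiffOn ℝ 1` within each open face, a relatively open subset of an affine
  subspace, i.e. `C¹` along the face); the submodules `semialgChains k N d`, `semialgC1Chains k N d` of
  the concrete singular chain group `CChain ℤ (Fin N → ℝ) d` (`Finsupp.supported`): Huber's
  `S^def_d`, `S^{def,C¹}_d` for subsets of `ℝ^N` (intersect with `chainsIn … U d` for `S_d(U)`).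
  All definitions with bodies; API: `extend_apply`, `isSemialgebraic_stdSimplex` (the standard
  simplex is `k`-semialgebraic), `extend_face` and `IsSemialg.face` (**proved**: faces of semialgebraic
  simplices are semialgebraic — the graph of `σ ∘ δᵢ` is the preimage of the graph of `σ` under a
  coordinate-linear map), hence `bd_mem_semialgChains` (`S^def_•` is a subcomplex), and `IsCycle`.
* `Huber2023_semialgChains_quasiIso` — **named fact** (D-0014): Proposition 7.4, the inclusions
  `S^def_•(U) ⊂ S^sing_•(U)` and `S^{def,C¹}_•(U) ⊂ S^sing_•(U)` are quasi-isomorphisms, for the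
  instance `X = U` an **open** `k`-semialgebraic subset of `ℝ^N` (a definable `C^∞`-manifold with the
  one-chart atlas), spelled out elementwise (Hatcher §2.1: a chain map is a quasi-isomorphism iff
  every cycle of the target is homologous to a cycle of the source and every cycle of the source that
  bounds in the target bounds in the source), with `ℤ` coefficients as printed.

## Faithfulness and design notes

* Instance, not generalisation. Huber's `X` ranges over definable `C^∞`-manifolds with corners; the
  tree has no carrier for that notion (no definable/Nash manifolds; `lean search Nash`, `definable
  manifold`: nothing), so the fact is vendored for open semialgebraic `U ⊆ ℝ^N` only — verbatim an
  instance (charts may be taken into `ℝ^N_{>0}` through the semialgebraic diffeomorphism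
  `x ↦ x + √(x²+1)` coordinatewise, if one insists on Definition 4.3's `ℝ^N_{≥0}`). A compact Nash
  submanifold `V ⊆ ℝ^N` (e.g. a Grassmannian) is reached by the consumer through a semialgebraic
  retraction `r : U → V` of an open semialgebraic neighbourhood (push the bounding chain forward by
  `r`); for the Grassmannian in the projector model `r` is the spectral projector, in general this is
  the Nash tubular neighbourhood theorem (BCR Cor. 8.9.5), not vendored here.
* The general comparison theorem behind it — Edmundo–Woerheide 2008 (o-minimal singular homology of
  a definable set over the reals ≅ singular homology), as cited in Huber's Remark 7.2 and proof — is
  paywalled and was not read (acq-02516); it is cited after Huber only.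
* "Definable with parameters in `k`" for the semialgebraic structure is `IsSemialgebraic k` of the
  tree (`k` a field with `Algebra k ℝ`, i.e. a subfield of `ℝ`); a continuous map on `Δ^d` is
  definable iff its graph over `Δ^d` is, which is `IsSemialgebraicMapOn k (stdSimplex ℝ _) (extend σ)`
  (`IsSemialgebraicMapOn` only reads the function on the given set).
* Not vendored: the simplicial comparison `S^Δ_•(X)` (needs a triangulation; see
  `SemialgebraicTriangulation`'s "What is NOT here"), `S^Stokes_•`, `S^∞_•`, the strictly-`C¹` complex of
  [CommelinHabeggerHuber2020] (simplices `C¹` up to the boundary; Huber Rem. 7.6) and the Ohmoto–Shiota panel beating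
  (J. Topol. 2017, Thm. 3.1) — printed refinements a consumer may request separately.
* Mathlib has singular homology (`AlgebraicTopology.singularHomologyFunctor`, here through the
  tree's concrete model `CChain`/`bd`/`chainsIn`) but no semialgebraic or o-minimal geometry.

## References

* [Huber2023] A. Huber (appendix with J. Commelin), *The period isomorphism in tame geometry*,
  Math. Nachr. 297 (2024) (doi:10.1002/mana.202200331; arXiv:2204.01402v2): §4 Def. 4.1, 4.3,
  Thm. 4.7; §5 (setting, p. 10); §7 Notation 7.1, Remark 7.2, Proposition 7.4 with proof, Remark 7.6
  (read).
* [EdmundoWoerheide2008] M. Edmundo, A. Woerheide, *Comparison theorems for o-minimal singular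
  (co)homology*, Trans. AMS 360 (2008) 4889–4912 (cited after [Huber2023]; not read, acq-02516).
* [CommelinHabeggerHuber2020] J. Commelin, P. Habegger, A. Huber, *Exponential periods and o-minimality*,
  arXiv:2007.08280, Ch. 3 (cited after [Huber2023]).
* [OhmotoShiota2017] T. Ohmoto, M. Shiota, *`C¹`-triangulations of semialgebraic sets*, J. Topol. 10
  (2017), Thms. 1.1, 2.2, 3.1, §4 (read).
* [Hatcher2002] A. Hatcher, *Algebraic Topology*, §2.1.
* [BCR1998] J. Bochnak, M. Coste, M.-F. Roy, *Real Algebraic Geometry*, Def. 2.2.5.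
-/

noncomputable section

open scoped Classical

open Set
open Literature.AlgebraicTopology.SingularHomology
open Literature.NumberTheory.Transcendental

namespace Literature.ModelTheory.ExponentialFields

/-! ### The standard simplex is semialgebraic -/

section StdSimplex

variable (k : Type*) [CommRing k] [Algebra k ℝ]

/-- The standard simplex `Δⁿ⁻¹ = {t ∈ ℝⁿ | tᵢ ≥ 0, ∑ tᵢ = 1}` is `k`-semialgebraic for every
coefficient ring `k` (it is cut out by the polynomials `Xᵢ ≥ 0`, `∑ Xᵢ - 1 = 0`). [folklore] -/
theorem isSemialgebraic_stdSimplex (n : ℕ) : IsSemialgebraic k (stdSimplex ℝ (Fin n)) := by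
  have h : stdSimplex ℝ (Fin n) =
      (⋂ i ∈ (Finset.univ : Finset (Fin n)),
          {t : Fin n → ℝ | 0 ≤ MvPolynomial.aeval t (MvPolynomial.X (R := k) i)}) ∩
        {t : Fin n → ℝ | MvPolynomial.aeval t ((∑ i, MvPolynomial.X (R := k) i) - 1) = 0} := by
    ext t
    simp [stdSimplex, sub_eq_zero]
  rw [h]
  exact (IsSemialgebraic.biInter _ _ fun i _ => isSemialgebraic_setOf_eval_nonneg _).inter
    (isSemialgebraic_setOf_eval_eq_zero _)

end StdSimplex

/-! ### Semialgebraic singular simplices of `ℝ^N` -/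

namespace SingularSimplex

variable {N d : ℕ}

/-- The singular simplex `σ : Δ^d → ℝ^N` (a continuous map on `stdSimplex ℝ (Fin (d+1)) ⊆ ℝ^{d+1}`)
extended by `0` off the standard simplex to a function `ℝ^{d+1} → ℝ^N`; only its values on `Δ^d`
matter below. [folklore] -/
def extend (σ : SingularSimplex (Fin N → ℝ) d) : (Fin (d + 1) → ℝ) → (Fin N → ℝ) :=
  fun t => if h : t ∈ stdSimplex ℝ (Fin (d + 1)) then SingularSimplex.toContinuousMap σ ⟨t, h⟩ else 0

/-- On the standard simplex, `extend σ` is `σ`. [folklore] -/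
theorem extend_apply (σ : SingularSimplex (Fin N → ℝ) d) (t : stdSimplex ℝ (Fin (d + 1))) :
    extend σ t = SingularSimplex.toContinuousMap σ t := by
  have h : ((t : Fin (d + 1) → ℝ)) ∈ stdSimplex ℝ (Fin (d + 1)) := t.2
  rw [extend, dif_pos h]
  exact congrArg _ (Subtype.ext rfl)

/-- On the standard simplex, `extend σ` is `σ` (membership form). [folklore] -/
theorem extend_apply_of_mem (σ : SingularSimplex (Fin N → ℝ) d) {t : Fin (d + 1) → ℝ}
    (ht : t ∈ stdSimplex ℝ (Fin (d + 1))) :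
    extend σ t = SingularSimplex.toContinuousMap σ ⟨t, ht⟩ := by
  simp [extend, ht]

variable (k : Type*) [CommRing k] [Algebra k ℝ]

/-- A singular simplex `σ : Δ^d → ℝ^N` is **`k`-semialgebraic** ("definable", Huber 2023/24,
Notation 7.1, for the structure of semialgebraic sets defined over `k`, §5): its graph over
`Δ^d ⊆ ℝ^{d+1}` is a `k`-semialgebraic subset of `ℝ^{(d+1)+N}` (BCR Def. 2.2.5, the tree's
`IsSemialgebraicMapOn`). [cite: Huber2023, Notation 7.1 and §5] -/
def IsSemialg (σ : SingularSimplex (Fin N → ℝ) d) : Prop :=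
  IsSemialgebraicMapOn k (stdSimplex ℝ (Fin (d + 1))) (extend σ)

end SingularSimplex

/-! ### Faces of semialgebraic simplices are semialgebraic -/

namespace SingularSimplex

variable {N d : ℕ}

/-- The `i`-th coface `δᵢ : ℝ^{d+1} → ℝ^{d+2}` as a linear map on all of `ℝ^{d+1}` (insert a zero
`i`-th coordinate): Mathlib's `FunOnFinite.linearMap ℝ ℝ (Fin.succAbove i)`, whose restriction to the
standard simplex is `stdSimplex.map (Fin.succAbove i)`, the map along which `SingularSimplex.face i`
restricts (Hatcher 2002, §2.1). [folklore] -/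
def cofaceLin (i : Fin (d + 2)) : (Fin (d + 1) → ℝ) →ₗ[ℝ] (Fin (d + 2) → ℝ) :=
  FunOnFinite.linearMap ℝ ℝ (Fin.succAbove i)

/-- `cofaceLin i` maps the standard `d`-simplex into the standard `(d+1)`-simplex. [folklore] -/
theorem cofaceLin_mem_stdSimplex (i : Fin (d + 2)) {t : Fin (d + 1) → ℝ}
    (ht : t ∈ stdSimplex ℝ (Fin (d + 1))) : cofaceLin i t ∈ stdSimplex ℝ (Fin (d + 2)) :=
  (stdSimplex.map (Fin.succAbove i) ⟨t, ht⟩).2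

/-- **The face of a singular simplex is the simplex composed with the coface**, at the level of the
extended functions: `extend (σ.face i) t = extend σ (δᵢ t)` for `t ∈ Δ^d` (Hatcher 2002, §2.1,
`σ|[v₀, …, v̂ᵢ, …, vₙ]`). [folklore] -/
theorem extend_face (i : Fin (d + 2)) (σ : SingularSimplex (Fin N → ℝ) (d + 1))
    {t : Fin (d + 1) → ℝ} (ht : t ∈ stdSimplex ℝ (Fin (d + 1))) :
    extend (σ.face i) t = extend σ (cofaceLin i t) := by
  rw [extend_apply_of_mem _ ht, extend_apply_of_mem _ (cofaceLin_mem_stdSimplex i ht),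
    SingularSimplex.toContinuousMap_face, ContinuousMap.comp_apply]
  exact congrArg _ (Subtype.ext rfl)

/-- The polynomial map `Φ : ℝ^{(d+1)+N} → ℝ^{(d+2)+N}`, `(t, x) ↦ (δᵢ t, x)`, as a family of
polynomials with coefficients in `k` (each coordinate is a sum of variables). [folklore] -/
def cofacePoly (k : Type*) [CommRing k] (N d : ℕ) (i : Fin (d + 2)) :
    Fin ((d + 2) + N) → MvPolynomial (Fin ((d + 1) + N)) k :=
  Fin.append
    (fun j : Fin (d + 2) =>
      ∑ x ∈ Finset.univ.filter (fun x : Fin (d + 1) => Fin.succAbove i x = j),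
        MvPolynomial.X (Fin.castAdd N x))
    (fun j : Fin N => MvPolynomial.X (Fin.natAdd (d + 1) j))

variable (k : Type*) [CommRing k] [Algebra k ℝ]

/-- Evaluating `cofacePoly`: `Φ(w) = (δᵢ (fst w), snd w)`. [folklore] -/
theorem aeval_cofacePoly (i : Fin (d + 2)) (w : Fin ((d + 1) + N) → ℝ) :
    (fun j => MvPolynomial.aeval w (cofacePoly k N d i j)) =
      Fin.append (cofaceLin i fun x => w (Fin.castAdd N x)) (fun j => w (Fin.natAdd (d + 1) j)) := by
  funext j
  refine Fin.addCases (fun j' => ?_) (fun j'' => ?_) j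
  · simp only [cofacePoly, Fin.append_left, map_sum, MvPolynomial.aeval_X, cofaceLin]
    rw [FunOnFinite.linearMap_apply_apply]
  · simp only [cofacePoly, Fin.append_right, MvPolynomial.aeval_X]

variable {k}

/-- The graph of a face over `Δ^d` is the preimage of the graph of the simplex over `Δ^{d+1}` under
`Φ : (t, x) ↦ (δᵢ t, x)`, cut back to `t ∈ Δ^d`. [folklore] -/
theorem graph_face_eq (i : Fin (d + 2)) (σ : SingularSimplex (Fin N → ℝ) (d + 1)) :
    {w : Fin ((d + 1) + N) → ℝ | ∃ t ∈ stdSimplex ℝ (Fin (d + 1)),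
        w = Fin.append t (extend (σ.face i) t)} =
      (fun w j => MvPolynomial.aeval w (cofacePoly k N d i j)) ⁻¹'
          {z : Fin ((d + 2) + N) → ℝ | ∃ s ∈ stdSimplex ℝ (Fin (d + 2)),
            z = Fin.append s (extend σ s)} ∩
        {w | (fun x => w (Fin.castAdd N x)) ∈ stdSimplex ℝ (Fin (d + 1))} := by
  ext w
  simp only [mem_setOf_eq, mem_inter_iff, mem_preimage, aeval_cofacePoly k]
  constructor
  · rintro ⟨t, ht, rfl⟩
    have h1 : (fun x => Fin.append t (extend (σ.face i) t) (Fin.castAdd N x)) = t := by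
      funext x
      rw [Fin.append_left]
    have h2 : (fun j => Fin.append t (extend (σ.face i) t) (Fin.natAdd (d + 1) j)) =
        extend (σ.face i) t := by
      funext j
      rw [Fin.append_right]
    refine ⟨⟨cofaceLin i t, cofaceLin_mem_stdSimplex i ht, ?_⟩, ?_⟩
    · rw [h1, h2, extend_face i σ ht]
    · rw [h1]
      exact ht
  · rintro ⟨⟨s, hs, hΦ⟩, ht⟩
    have hs' : cofaceLin i (fun x => w (Fin.castAdd N x)) = s := by
      funext j
      have := congrFun hΦ (Fin.castAdd N j)
      rwa [Fin.append_left, Fin.append_left] at this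
    have hx : (fun j => w (Fin.natAdd (d + 1) j)) = extend σ s := by
      funext j
      have := congrFun hΦ (Fin.natAdd (d + 2) j)
      rwa [Fin.append_right, Fin.append_right] at this
    refine ⟨fun x => w (Fin.castAdd N x), ht, ?_⟩
    rw [extend_face i σ ht, hs', ← hx, Fin.append_castAdd_natAdd]

/-- **Faces of `k`-semialgebraic singular simplices are `k`-semialgebraic** (so `S^def_•` is a
subcomplex, Huber 2023/24, Notation 7.1: "the groups organise into a complex with the standard
differential"): the graph of `σ ∘ δᵢ` is, by `graph_face_eq`, the preimage of the graph of `σ` under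
a polynomial map, cut back to the (semialgebraic) standard simplex. [cite: Huber2023, Notation 7.1] -/
theorem IsSemialg.face {σ : SingularSimplex (Fin N → ℝ) (d + 1)} (hσ : IsSemialg k σ)
    (i : Fin (d + 2)) : IsSemialg k (σ.face i) := by
  unfold IsSemialg IsSemialgebraicMapOn at hσ ⊢
  rw [graph_face_eq (k := k) i σ]
  refine (hσ.preimage_aeval (cofacePoly k N d i)).inter ?_
  have h : {w : Fin ((d + 1) + N) → ℝ | (fun x => w (Fin.castAdd N x)) ∈ stdSimplex ℝ (Fin (d + 1))} =
      (fun (w : Fin ((d + 1) + N) → ℝ) (x : Fin (d + 1)) =>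
        MvPolynomial.aeval w (MvPolynomial.X (R := k) (Fin.castAdd N x))) ⁻¹'
          stdSimplex ℝ (Fin (d + 1)) := by
    ext w
    simp only [mem_setOf_eq, mem_preimage, MvPolynomial.aeval_X]
  rw [h]
  exact (isSemialgebraic_stdSimplex k (d + 1)).preimage_aeval _

end SingularSimplex

/-- The **open face** of `Δ^d` spanned by the vertices in `J`: the points of the standard simplex
whose support is exactly `J` (for `J = univ` the open simplex, for `J = {i}` the vertex `eᵢ`, for
`J = ∅` the empty set). [cite: Huber2023, Notation 7.1 ("open faces")] -/
def openFace (d : ℕ) (J : Finset (Fin (d + 1))) : Set (Fin (d + 1) → ℝ) :=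
  {t | t ∈ stdSimplex ℝ (Fin (d + 1)) ∧ ∀ i, 0 < t i ↔ i ∈ J}

/-- Open faces lie in the standard simplex. [folklore] -/
theorem openFace_subset_stdSimplex (d : ℕ) (J : Finset (Fin (d + 1))) :
    openFace d J ⊆ stdSimplex ℝ (Fin (d + 1)) :=
  fun _ ht => ht.1

/-- Every point of `Δ^d` lies in exactly one open face, the one indexed by its support. [folklore] -/
theorem mem_openFace_support {d : ℕ} {t : Fin (d + 1) → ℝ} (ht : t ∈ stdSimplex ℝ (Fin (d + 1))) :
    t ∈ openFace d (Finset.univ.filter fun i => 0 < t i) :=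
  ⟨ht, fun i => by simp⟩

namespace SingularSimplex

variable {N d : ℕ}

/-- `σ : Δ^d → ℝ^N` is **`C¹` on all open faces** (Huber 2023/24, Notation 7.1, with Def. 4.1/4.3: `C¹`
as a map on the manifold-with-corners `Δ^d` restricted to each open face): for every `J`,
`extend σ` is `C¹` within the open face `openFace d J` (Mathlib `ContDiffOn`, derivatives taken
within the face, a relatively open subset of the affine subspace it spans).
[cite: Huber2023, Notation 7.1] -/
def ContDiffOnOpenFaces (σ : SingularSimplex (Fin N → ℝ) d) : Prop :=
  ∀ J : Finset (Fin (d + 1)), ContDiffOn ℝ 1 (extend σ) (openFace d J)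

end SingularSimplex

/-! ### The subcomplexes `S^def_•` and `S^{def,C¹}_•` -/

section Chains

variable (k : Type*) [CommRing k] [Algebra k ℝ] (N d : ℕ)

/-- The `k`-semialgebraic singular `d`-simplices of `ℝ^N`. [cite: Huber2023, Notation 7.1] -/
def semialgSimplices : Set (SingularSimplex (Fin N → ℝ) d) :=
  {σ | SingularSimplex.IsSemialg k σ}

/-- The `k`-semialgebraic singular `d`-simplices of `ℝ^N` that are `C¹` on all open faces.
[cite: Huber2023, Notation 7.1] -/
def semialgC1Simplices : Set (SingularSimplex (Fin N → ℝ) d) :=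
  {σ | SingularSimplex.IsSemialg k σ ∧ SingularSimplex.ContDiffOnOpenFaces σ}

/-- Huber's `S^def_d` for subsets of `ℝ^N`: the subgroup of concrete singular `d`-chains of `ℝ^N` with
`ℤ` coefficients supported on `k`-semialgebraic simplices (`Finsupp.supported`); for `U ⊆ ℝ^N`,
`S^def_d(U) = chainsIn ℤ ℤ _ U d ⊓ semialgChains k N d`. [cite: Huber2023, Notation 7.1] -/
def semialgChains : Submodule ℤ (CChain ℤ (Fin N → ℝ) d) :=
  Finsupp.supported ℤ ℤ (semialgSimplices k N d)

/-- Huber's `S^{def,C¹}_d` for subsets of `ℝ^N`: chains supported on `k`-semialgebraic simplices that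
are `C¹` on all open faces. [cite: Huber2023, Notation 7.1] -/
def semialgC1Chains : Submodule ℤ (CChain ℤ (Fin N → ℝ) d) :=
  Finsupp.supported ℤ ℤ (semialgC1Simplices k N d)

variable {k N d}

/-- Membership in `S^def_d`: every simplex of the chain is semialgebraic. [folklore] -/
theorem mem_semialgChains_iff (c : CChain ℤ (Fin N → ℝ) d) :
    c ∈ semialgChains k N d ↔ ∀ σ ∈ c.support, SingularSimplex.IsSemialg k σ := by
  rw [semialgChains, Finsupp.mem_supported']
  constructor
  · intro h σ hσ
    by_contra hs
    exact (Finsupp.mem_support_iff.mp hσ) (h σ hs)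
  · intro h σ hσ
    by_contra hc
    exact hσ (h σ (Finsupp.mem_support_iff.mpr hc))

/-- `S^{def,C¹}_d ≤ S^def_d`. [cite: Huber2023, Proposition 7.4 (the inclusion)] -/
theorem semialgC1Chains_le_semialgChains : semialgC1Chains k N d ≤ semialgChains k N d :=
  Finsupp.supported_mono fun _ h => h.1

/-- An elementary chain `m • σ` with `σ` semialgebraic lies in `S^def_d`. [folklore] -/
theorem single_mem_semialgChains {σ : SingularSimplex (Fin N → ℝ) d}
    (hσ : SingularSimplex.IsSemialg k σ) (m : ℤ) : Finsupp.single σ m ∈ semialgChains k N d :=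
  Finsupp.single_mem_supported ℤ m hσ

/-- **`S^def_•` is a subcomplex**: the boundary of a chain of semialgebraic simplices is a chain of
semialgebraic simplices (Huber 2023/24, Notation 7.1: "the groups organise into a complex with the
standard differential for singular homology"; by `IsSemialg.face`). [cite: Huber2023, Notation 7.1] -/
theorem bd_mem_semialgChains {c : CChain ℤ (Fin N → ℝ) (d + 1)} (hc : c ∈ semialgChains k N (d + 1)) :
    csingularChainComplex.bd ℤ d c ∈ semialgChains k N d := by
  have h : semialgChains k N (d + 1) ≤
      (semialgChains k N d).comap (csingularChainComplex.bd ℤ d) := by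
    rw [semialgChains, Finsupp.supported_eq_span_single, Submodule.span_le]
    rintro _ ⟨σ, hσ, rfl⟩
    have hσ' : SingularSimplex.IsSemialg k σ := hσ
    simp only [SetLike.mem_coe, Submodule.mem_comap, csingularChainComplex.bd_single]
    exact Submodule.sum_mem _ fun i _ =>
      Submodule.smul_mem _ _ (single_mem_semialgChains (hσ'.face i) 1)
  exact h hc

end Chains

/-! ### Cycles of the concrete singular chain complex -/

section Cycles

variable {X : Type} [TopologicalSpace X]

/-- `z` is a **cycle** of the concrete singular chain complex with `ℤ` coefficients: `∂ z = 0`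
(every `0`-chain is a cycle). Hatcher 2002, §2.1. [folklore] -/
def IsCycle : {d : ℕ} → CChain ℤ X d → Prop
  | 0, _ => True
  | _ + 1, z => csingularChainComplex.bd ℤ _ z = 0

/-- Every `0`-chain is a cycle. [folklore] -/
@[simp] theorem isCycle_zero (z : CChain ℤ X 0) : IsCycle z := trivial

/-- In positive degrees a cycle is a chain with zero boundary. [folklore] -/
@[simp] theorem isCycle_succ_iff {d : ℕ} (z : CChain ℤ X (d + 1)) :
    IsCycle z ↔ csingularChainComplex.bd ℤ d z = 0 := Iff.rfl

/-- **The chains of `A` supported in `U` compute the homology of `U`** — the elementwise form of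
"the inclusion of the subcomplex `S_•(U) ∩ A_•` into the singular chains `S_•(U)` of `ℝ^N` supported
in `U` is a quasi-isomorphism" (Hatcher 2002, §2.1: a chain map induces a bijection on homology iff
(i) every cycle of the target is homologous to a cycle in the image and (ii) every cycle of the
source that bounds in the target bounds in the source): (i) for every cycle `z ∈ S_d(U)` there are
`a ∈ S_d(U) ∩ A_d` and `c ∈ S_{d+1}(U)` with `z - a = ∂ c`; (ii) every `a ∈ S_d(U) ∩ A_d` with
`a = ∂ c`, `c ∈ S_{d+1}(U)`, is `∂ c'` for some `c' ∈ S_{d+1}(U) ∩ A_{d+1}`. [folklore] -/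
def ComputesHomologyIn {N : ℕ} (U : Set (Fin N → ℝ))
    (A : (d : ℕ) → Submodule ℤ (CChain ℤ (Fin N → ℝ) d)) : Prop :=
  (∀ (d : ℕ) (z : CChain ℤ (Fin N → ℝ) d), z ∈ chainsIn ℤ ℤ (Fin N → ℝ) U d → IsCycle z →
      ∃ a ∈ chainsIn ℤ ℤ (Fin N → ℝ) U d ⊓ A d, ∃ c ∈ chainsIn ℤ ℤ (Fin N → ℝ) U (d + 1),
        z - a = csingularChainComplex.bd ℤ d c) ∧
  (∀ (d : ℕ) (a : CChain ℤ (Fin N → ℝ) d), a ∈ chainsIn ℤ ℤ (Fin N → ℝ) U d ⊓ A d →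
      (∃ c ∈ chainsIn ℤ ℤ (Fin N → ℝ) U (d + 1), csingularChainComplex.bd ℤ d c = a) →
        ∃ c' ∈ chainsIn ℤ ℤ (Fin N → ℝ) U (d + 1) ⊓ A (d + 1),
          csingularChainComplex.bd ℤ d c' = a)

/-- The top subcomplex computes the homology of `U` (sanity check of the elementwise form:
take `a = z`, `c = 0`, resp. `c' = c`). [folklore] -/
theorem computesHomologyIn_top {N : ℕ} (U : Set (Fin N → ℝ)) :
    ComputesHomologyIn U (fun _ => ⊤) := by
  refine ⟨fun d z hz _ => ⟨z, ⟨hz, trivial⟩, 0, Submodule.zero_mem _, by simp⟩, ?_⟩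
  rintro d a ⟨ha, -⟩ ⟨c, hc, rfl⟩
  exact ⟨c, ⟨hc, trivial⟩, rfl⟩

end Cycles

/-! ### The named fact -/

/-- **Semialgebraic singular chains compute singular homology** (Huber 2023/24, Proposition 7.4:
for a subfield `k ⊆ ℝ` and `X` a definable `C^∞`-manifold with corners — definable meaning
semialgebraic over `k` — "the inclusions `S^def_•(X) ⊂ S^sing_•(X)`, `S^{def,C¹}_•(X) ⊂ S^def_•(X)`
… are natural quasi-isomorphisms", `S^def_d(X)`, resp. `S^{def,C¹}_d(X)`, being the free abelian
group on the definable continuous `σ : Δ_d → X`, resp. those `C¹` on all open faces; proof by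
Warner's fine-resolution argument (Thm. 4.7), "alternatively … the main comparison theorem of
Edmundo and Woerheide [EW08]"), **for the instance `X = U` an open `k`-semialgebraic subset of
`ℝ^N`**, elementwise (`ComputesHomologyIn`) and with `ℤ` coefficients: writing `S_d(U)` for the
singular `d`-chains of `ℝ^N` supported in `U` (`chainsIn`) and `A_d` for either `S^def_d`
(`semialgChains`) or `S^{def,C¹}_d` (`semialgC1Chains`), (i) every cycle `z ∈ S_d(U)` is homologous
in `U` to a chain of `A_d`: `z - a = ∂ c` with `a ∈ S_d(U) ∩ A_d`, `c ∈ S_{d+1}(U)`; (ii) every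
`a ∈ S_d(U) ∩ A_d` which bounds in `U`, `a = ∂ c` with `c ∈ S_{d+1}(U)`, bounds in `A`: `a = ∂ c'`
with `c' ∈ S_{d+1}(U) ∩ A_{d+1}` — i.e. `H_•(S_•(U) ∩ A_•) → H_•(U; ℤ)` is bijective (Hatcher
§2.1). In particular a `k`-semialgebraic (`C¹` on open faces) cycle in `U` whose class vanishes in
`H_d(U; ℤ)` bounds a `k`-semialgebraic (`C¹` on open faces) chain in `U`. Named fact (D-0014).
[cite: Huber2023, Proposition 7.4 with Notation 7.1, Remark 7.2 and §5]
[cite: EdmundoWoerheide2008, main comparison theorem (as cited in Huber2023, proof of Prop. 7.4)] -/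
def Huber2023_semialgChains_quasiIso : Prop :=
  ∀ (k : Type) [Field k] [Algebra k ℝ] (N : ℕ) (U : Set (Fin N → ℝ)),
    IsOpen U → IsSemialgebraic k U →
      ComputesHomologyIn U (fun d => semialgChains k N d) ∧
        ComputesHomologyIn U (fun d => semialgC1Chains k N d)

end Literature.ModelTheory.ExponentialFields
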